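import Summits.AnomalousDissipation.AnomalousDissipation.Theorems.SolenoidalFractalHomogenisationLagrangianStepVmodHigh
import Summits.AnomalousDissipation.AnomalousDissipation.Theorems.SolenoidalFractalHomogenisationLagrangianStepVmodSfAssembly
import Summits.AnomalousDissipation.AnomalousDissipation.Theorems.SolenoidalFractalHomogenisationLagrangianStepVmodSlowTestTools
import Literature.Analysis.FluidPDE.PassiveVectorTensorPropagatorPeriodic
import HarnessLib

/-!
# K1L_D (stmt-AnomalousDissipation-27980): (V_mod) flat stage, block (sf) — HIGH LABELS: W7 at the propagator level for GENERAL class-pair data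
# and at GENERAL carrier phase (prover ad-k3l-bookkeeping-p1 g10, (sf) owner by RULING D28-5; helper `--supports 27980 --as helper`)

Generalises prover ad-sawtooth-k1loc-p1 g15's `VmodGen.norm_apply_le_of_highLabelDecay` (W7 `HighLabelDecayW` read on a single real mode PAIR at
carrier phase 0) in the two directions the (sf) block needs (its text `VmodFlat.SFMode_textEVH` is at GENERAL phase — load-bearing for ad-k3l g9's
`bffEVH_of_bsfEVH` — and the head window `[s, P⌈s/P⌉]` turns a pair datum into a general CLASS-PAIR state):
* `norm_apply_le_of_highLabelDecay_supp` — phase 0, datum `v ∈ divFreeL2` carried by the class pair of `ℓ` AND finitely supported (`freqBall N`):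
  the real trigonometric truncation `fourierTruncate N ⇑v` is an admissible `IsDatum` without Bloch labels of norm `< L` (class-pair arithmetic
  `norm_latticeVec_ge_of_classPair_ne`), so W7 + the energy representative (`exists_sol_modeRep_energy`) give `‖U s t v‖ ≤ √CK·e^{−cKν(t−s)}‖v‖`;
* `norm_apply_le_of_highLabelDecay_classPair` — the same for EVERY `v ∈ divFreeL2` carried by the class pair (density: `P_σ` of the truncations
  `→ v`, `U s t` and the norm are continuous);
* **`norm_apply_le_of_highLabelDecay_anyPhase`** — GENERAL phase `s`, window `t − s ≥ P := M·W.period/ν`: move to the next grid point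
  `s₁ = ⌈s/P⌉·P ∈ [s, s+P)` by the cocycle (`U s t = U s₁ t ∘ U s s₁`; the state at `s₁` is again a class-pair datum by class preservation,
  `PropagatorSymm.fcoeff_apply_eq_zero_of_classes` + `VmodFlat.classPair_of_classPair_of_classPair`), restart there (`cellField_add_nat_mul_period`):
  `‖U s t v‖ ≤ √CK·exp(cK·M·W.period)·exp(−cK·ν·(t−s))·‖v‖`.
Certifier table `Lines/onelevel-ss-regimes.md` §2 T-H, §1 (R-f), §4 (sf) high classes.  `sorry`-free; NOT a proof of (sf), of the stub, of K1L_D or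
of AD; rung F-D1.A0.
-/

set_option linter.dupNamespace false

noncomputable section

namespace Summit.AnomalousDissipation.AnomalousDissipation.Theorems.SolenoidalFractalHomogenisation.LagrangianStep.VmodGen

open Set MeasureTheory Complex UnitAddTorus Filter Topology
open scoped InnerProductSpace ENNReal
open Literature.Analysis Literature.Analysis.FunctionSpaces Literature.Analysis.FunctionSpaces.Torus
open Literature.Analysis.FluidPDE Literature.Analysis.FluidPDE.Torus Literature.Analysis.FluidPDE.LatticeShear
open Summit.AnomalousDissipation.AnomalousDissipation.Theorems.SolenoidalFractalHomogenisation.LagrangianStep.CellChain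
  (modeRep le_on_Icc_of_ae_le norm_latticeVec_ge_of_classPair_ne)
open Summit.AnomalousDissipation.AnomalousDissipation.Theorems.SolenoidalFractalHomogenisation.LagrangianStep.VmodFlat
  (fc fc_sub fc_toLp_fourierTruncate classPair_of_classPair_of_classPair)
open Summit.AnomalousDissipation.AnomalousDissipation.Theorems.SolenoidalFractalHomogenisation.RealisedQuasiStaticCellLaw
  (isSmooth_cell isDivFree_cell memLp_top_stLift_cell)

variable {k : ℕ}

/-! ## §1 Class-pair arithmetic -/

/-- A frequency congruent to `±ℓ (mod n)` differs from `±ℓ` by `n`-multiples: the `∃ z` form consumed by `norm_latticeVec_ge_of_classPair_ne`. -/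
theorem exists_classPair_repr {n : ℕ} {ℓ k' : Fin 3 → ℤ} (h : (∀ i, (n:ℤ) ∣ k' i - ℓ i) ∨ (∀ i, (n:ℤ) ∣ k' i + ℓ i)) :
    (∃ z : Fin 3 → ℤ, k' = ℓ + (n : ℤ) • z) ∨ (∃ z : Fin 3 → ℤ, k' = -ℓ + (n : ℤ) • z) := by
  rcases h with h | h
  · refine Or.inl ⟨fun i => (k' i - ℓ i) / n, funext fun i => ?_⟩
    have e := Int.mul_ediv_cancel' (h i)
    simp only [Pi.add_apply, Pi.smul_apply, smul_eq_mul]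
    linarith
  · refine Or.inr ⟨fun i => (k' i + ℓ i) / n, funext fun i => ?_⟩
    have e := Int.mul_ediv_cancel' (h i)
    simp only [Pi.add_apply, Pi.neg_apply, Pi.smul_apply, smul_eq_mul]
    linarith

/-- In a class pair of a label with `2‖ℓ‖ ≤ n`, every frequency has norm `≥ ‖ℓ‖`. -/
theorem norm_latticeVec_ge_of_classPair {n : ℕ} {ℓ k' : Fin 3 → ℤ} (h : (∀ i, (n:ℤ) ∣ k' i - ℓ i) ∨ (∀ i, (n:ℤ) ∣ k' i + ℓ i))
    (hℓn : 2 * ‖Torus.latticeVec ℓ‖ ≤ n) : ‖Torus.latticeVec ℓ‖ ≤ ‖Torus.latticeVec k'‖ := by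
  by_cases h1 : k' = ℓ
  · rw [h1]
  · by_cases h2 : k' = -ℓ
    · rw [h2, Torus.latticeVec_neg, norm_neg]
    · have := norm_latticeVec_ge_of_classPair_ne (exists_classPair_repr h) h1 h2
      linarith

/-- A nonzero label with `2‖ℓ‖ ≤ n`, `1 ≤ n`, is not congruent to `0`: the zero frequency is off its class pair. -/
theorem zero_not_mem_classPair {n : ℕ} (hn : 1 ≤ n) {ℓ : Fin 3 → ℤ} (hℓ0 : ℓ ≠ 0) (hℓn : 2 * ‖Torus.latticeVec ℓ‖ ≤ n) :
    ¬ ((∀ i, (n:ℤ) ∣ (0 : Fin 3 → ℤ) i - ℓ i) ∨ (∀ i, (n:ℤ) ∣ (0 : Fin 3 → ℤ) i + ℓ i)) := by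
  intro h
  have h0ℓ : (0 : Fin 3 → ℤ) ≠ ℓ := fun e => hℓ0 e.symm
  have h0ℓ' : (0 : Fin 3 → ℤ) ≠ -ℓ := fun e => hℓ0 (by rw [← neg_neg ℓ, ← e, neg_zero])
  have h1 := norm_latticeVec_ge_of_classPair_ne (exists_classPair_repr h) h0ℓ h0ℓ'
  have h2 : ‖Torus.latticeVec (0 : Fin 3 → ℤ)‖ = 0 := by
    rw [show (0 : Fin 3 → ℤ) = -0 by simp, Torus.latticeVec_neg]; simp
  have h3 : (1:ℝ) ≤ n := by exact_mod_cast hn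
  have h4 : 0 ≤ ‖Torus.latticeVec ℓ‖ := norm_nonneg _
  linarith

/-! ## §2 W7 at the propagator level: finitely supported class-pair data, phase 0 -/

set_option maxHeartbeats 1600000 in
/-- **W7 AT THE PROPAGATOR LEVEL ON A FINITELY SUPPORTED CLASS-PAIR DATUM** (phase 0).  As `norm_apply_le_of_highLabelDecay`, for
`v ∈ divFreeL2` carried by the class pair of `ℓ` and supported in `freqBall N`. [cite: BedrossianCotiZelati2017, Thm 1.1] [cite: Temam1984, Ch. III §1 Lemma 1.2] -/
theorem norm_apply_le_of_highLabelDecay_supp (W : LatticeWord k) (M : ℝ) (hM : 0 < M) {lo hi Λ β νh Kb CK cK : ℝ}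
    (hH : HighLabelDecayW W M hM lo hi Λ β νh Kb CK cK) (hlo : 0 < lo) (hhi : 0 ≤ hi) (hΛ : 1 ≤ Λ) (hCK : 0 ≤ CK)
    {ν : ℝ} (hν : ν ∈ Set.Ioo 0 νh) {n : ℕ} (hn : 1 ≤ n) {𝔸 : Visc4 (Fin 3)} (hodd : OddSmall 𝔸 (ν * β))
    (hwin : ∃ lam ∈ Set.Icc (1:ℝ) Λ, NearIso 𝔸 (ν * (lo / lam)) (ν * (hi * lam)))
    {Tw : ℝ} {U : ℝ → ℝ → (V2 →L[ℝ] V2)} (hU : IsPropagator Tw (cellField W M hM ν hν.1 n) ((1 / (n:ℝ) ^ 2) • 𝔸) U)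
    {s t : ℝ} (hs : 0 ≤ s) (hst : s ≤ t) (htT : t ≤ Tw) (hsT : s < Tw)
    (hphase : ∀ τ, cellField W M hM ν hν.1 n (s + τ) = cellField W M hM ν hν.1 n τ)
    {L : ℝ} (hL : 0 < L) (hKL : (n : ℝ) * ν ≤ Kb * L)
    {ℓ : Fin 3 → ℤ} (hℓ0 : ℓ ≠ 0) (hℓL : L ≤ ‖Torus.latticeVec ℓ‖) (hℓn : 2 * ‖Torus.latticeVec ℓ‖ ≤ n)
    (v : V2) (hv : v ∈ divFreeL2 (Fin 3))
    (hvs : ∀ k', fc v k' ≠ 0 → (∀ i, (n:ℤ) ∣ k' i - ℓ i) ∨ (∀ i, (n:ℤ) ∣ k' i + ℓ i))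
    {N : ℕ} (hvN : ∀ k', k' ∉ Torus.freqBall (d := Fin 3) N → fc v k' = 0) :
    ‖U s t v‖ ≤ Real.sqrt CK * Real.exp (-(cK * ν * (t - s))) * ‖v‖ := by
  classical
  have hnpos : 0 < n := hn
  have hn0 : (0:ℝ) < n := by exact_mod_cast hnpos
  have hn2 : (0:ℝ) < 1 / (n:ℝ) ^ 2 := by positivity
  have hL0 : 0 < Tw - s := by linarith
  have hAΛ : NearIso 𝔸 (ν * (lo / Λ)) (ν * (hi * Λ)) := by
    obtain ⟨lam, hlam, hA⟩ := hwin
    have hlam1 : 0 < lam := lt_of_lt_of_le one_pos hlam.1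
    exact hA.mono (mul_le_mul_of_nonneg_left (div_le_div_of_nonneg_left hlo.le hlam1 hlam.2) hν.1.le)
      (mul_le_mul_of_nonneg_left (mul_le_mul_of_nonneg_left hlam.2 hhi) hν.1.le)
  have hN' : NearIso ((1 / (n:ℝ) ^ 2) • 𝔸) ((1 / (n:ℝ) ^ 2) * (ν * (lo / Λ))) ((1 / (n:ℝ) ^ 2) * (ν * (hi * Λ))) := hAΛ.smul hn2.le
  have hloU : 0 < (1 / (n:ℝ) ^ 2) * (ν * (lo / Λ)) := by
    have hΛ0 : 0 < Λ := lt_of_lt_of_le one_pos hΛ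
    have hν0 : 0 < ν := hν.1
    positivity
  -- the bridge with energy, along the stretched word's cell field
  set W₁ : LatticeWord k := (W.stretch M hM).stretch (1 / ν) (one_div_pos.mpr hν.1) with hW₁
  have hU' : IsPropagator Tw (W₁.cell n) ((1 / (n:ℝ) ^ 2) • 𝔸) U := hU
  have hphase' : ∀ τ, W₁.cell n (s + τ) = W₁.cell n τ := hphase
  have hvdiv : FunctionSpaces.Torus.IsWeaklyDivFree (v : VF) := (mem_divFreeL2_iff v).1 hv
  obtain ⟨u, E, Q, hu, -, hE0, hEc, -, -, hEae, -, -, hUE⟩ := exists_sol_modeRep_energy W₁ n hN' hloU hU' hs hsT hphase' v hvdiv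
  -- the real trigonometric truncation IS the datum (finite support) and is admissible for the clause
  set F : VF := FunctionSpaces.Torus.fourierTruncate N (v : VF) with hF
  have hF2 : MemLp F 2 volume := (FunctionSpaces.Torus.isSmooth_fourierTruncate N (v : VF)).memLp 2
  have hFi : Integrable F volume := hF2.integrable one_le_two
  have hvF : v = hF2.toLp F := by
    refine (VmodFlat.eq_of_fc_eq fun k' => ?_).symm
    rw [fc_toLp_fourierTruncate]
    split_ifs with hk'
    · rfl
    · exact (hvN k' hk').symm
  have hFv : (F : VF) =ᵐ[volume] ⇑v := by rw [hvF]; exact (MemLp.coeFn_toLp hF2).symm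
  have hFdiv : FunctionSpaces.Torus.IsWeaklyDivFree F := hvdiv.congr_ae hFv.symm
  have hcoef : ∀ k', mFourierCoeff (FunctionSpaces.EuclideanSpace.complexify ∘ F) k' = fc v k' := fun k' =>
    FunctionSpaces.Torus.mFourierCoeff_congr_ae (hFv.fun_comp FunctionSpaces.EuclideanSpace.complexify) k'
  -- no zero mode (the zero frequency is off the class pair)
  have hv0 : fc v 0 = 0 := by
    by_contra h
    exact zero_not_mem_classPair hn hℓ0 hℓn (hvs 0 h)
  have hdatum : IsDatum F := by
    refine ⟨(FunctionSpaces.Torus.isSmooth_fourierTruncate N (v : VF)).memSobolev_one_complexify, ?_, hFdiv⟩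
    refine hasZeroMean_of_mFourierCoeff_zero ?_
    rw [hcoef]; exact hv0
  -- the datum carries no Bloch label of norm `< L`
  have hlab : ∀ k' : Fin 3 → ℤ, (∃ ℓ' z : Fin 3 → ℤ, ‖Torus.latticeVec ℓ'‖ < L ∧ k' = ℓ' + (n : ℤ) • z) → ∀ i, modeCoeff k' F i = 0 := by
    intro k' hk' i
    rw [modeCoeff_eq hFi, hcoef]
    obtain ⟨ℓ', z, hℓ'L, hk'eq⟩ := hk'
    suffices h : fc v k' = 0 by rw [h]; rfl
    by_contra hne
    have hcp := hvs k' hne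
    -- `ℓ' = k' − n•z` is in the class pair of `ℓ` as well
    have hcp' : (∀ i, (n:ℤ) ∣ ℓ' i - ℓ i) ∨ (∀ i, (n:ℤ) ∣ ℓ' i + ℓ i) := by
      have hzk : ∀ i, (n:ℤ) ∣ ℓ' i - k' i := fun i => ⟨-z i, by rw [hk'eq]; simp⟩
      rcases hcp with h | h
      · left; intro i
        have := dvd_add (hzk i) (h i)
        rwa [show ℓ' i - k' i + (k' i - ℓ i) = ℓ' i - ℓ i by ring] at this
      · right; intro i
        have := dvd_add (hzk i) (h i)
        rwa [show ℓ' i - k' i + (k' i + ℓ i) = ℓ' i + ℓ i by ring] at this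
    have hge := norm_latticeVec_ge_of_classPair hcp' hℓn
    linarith
  -- the clause along the cell field (the Lions solution from `⇑v` is a solution from `F`)
  have hu' : IsWeakTensorPassiveVectorOn 0 (Tw - s) ((1 / (n:ℝ) ^ 2) • 𝔸) (cellField W M hM ν hν.1 n) F u := hu.congr_datum hFv
  have hdecay := hH ν hν n hn 𝔸 hodd hwin L hL hKL F hdatum hlab (Tw - s) hL0 u hu'
  have hFnorm : ∫ x, ‖F x‖ ^ 2 = ‖v‖ ^ 2 := by
    rw [OneLevelSplit.norm_sq_eq_integral]
    exact integral_congr_ae (hFv.mono fun x hx => by simp only [hx])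
  -- the energy representative obeys the decay at EVERY time
  set G : ℝ → ℝ := fun τ => CK * Real.exp (-(2 * cK * ν * τ)) * ‖v‖ ^ 2 with hG
  have hae : ∀ᵐ τ ∂(volume.restrict (Ioo 0 (Tw - s))), E τ ≤ G τ := by
    filter_upwards [hdecay, hEae] with τ hτ hEτ
    rw [hEτ, hG]; dsimp only; rw [← hFnorm]; exact hτ
  have hGc : ContinuousOn G (Icc 0 (Tw - s)) :=
    ((continuous_const.mul (Real.continuous_exp.comp (continuous_const.mul continuous_id).neg)).mul continuous_const).continuousOn
  have hall := le_on_Icc_of_ae_le hL0 hEc hGc hae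
  have hτ : t - s ∈ Icc 0 (Tw - s) := ⟨by linarith, by linarith⟩
  have est : s + (t - s) = t := by ring
  have h1 : ‖U s t v‖ ^ 2 ≤ G (t - s) := by
    have h := hUE (t - s) hτ
    rw [est] at h
    exact h.trans (hall (t - s) hτ)
  have h2 : G (t - s) = (Real.sqrt CK * Real.exp (-(cK * ν * (t - s))) * ‖v‖) ^ 2 := by
    rw [hG]; dsimp only
    rw [mul_pow, mul_pow, Real.sq_sqrt hCK, ← Real.exp_nat_mul]
    congr 2; push_cast; ring
  rw [h2] at h1
  exact (pow_le_pow_iff_left₀ (norm_nonneg _) (by positivity) two_ne_zero).1 h1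

/-! ## §3 Density: every class-pair datum, phase 0 -/

/-- **`T_N v → v` in `V2`** for the `MemLp.toLp` classes of the Fourier truncations of `v ∈ V2` (the Parseval tail,
`Torus.tendsto_eLpNorm_fourierTruncate_sub`). [cite: RobinsonRodrigoSadowski2016, Lemma 4.1, p. 74] -/
theorem tendsto_toLp_fourierTruncate_V2 (v : V2) :
    Tendsto (fun N => ((FunctionSpaces.Torus.isSmooth_fourierTruncate N (v : VF)).memLp 2).toLp
      (FunctionSpaces.Torus.fourierTruncate N (v : VF))) atTop (𝓝 v) := by
  rw [tendsto_iff_norm_sub_tendsto_zero]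
  have h := FunctionSpaces.Torus.tendsto_eLpNorm_fourierTruncate_sub (Lp.memLp v)
  have h' : Tendsto (fun N => (eLpNorm (FunctionSpaces.Torus.fourierTruncate N (v : VF) - (v : VF)) 2 volume).toReal) atTop (𝓝 0) := by
    have := (ENNReal.tendsto_toReal ENNReal.zero_ne_top).comp h
    rwa [ENNReal.toReal_zero] at this
  refine h'.congr fun N => ?_
  rw [Lp.norm_def]
  congr 1
  refine eLpNorm_congr_ae ?_
  filter_upwards [Lp.coeFn_sub (((FunctionSpaces.Torus.isSmooth_fourierTruncate N (v : VF)).memLp 2).toLp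
      (FunctionSpaces.Torus.fourierTruncate N (v : VF))) v,
    MemLp.coeFn_toLp ((FunctionSpaces.Torus.isSmooth_fourierTruncate N (v : VF)).memLp 2)] with x hx h1
  rw [hx, Pi.sub_apply, Pi.sub_apply, h1]

set_option maxHeartbeats 1600000 in
/-- **W7 AT THE PROPAGATOR LEVEL ON EVERY CLASS-PAIR DATUM** (phase 0; density of the truncations).
[cite: BedrossianCotiZelati2017, Thm 1.1] [cite: RobinsonRodrigoSadowski2016, Lemma 4.1] -/
theorem norm_apply_le_of_highLabelDecay_classPair (W : LatticeWord k) (M : ℝ) (hM : 0 < M) {lo hi Λ β νh Kb CK cK : ℝ}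
    (hH : HighLabelDecayW W M hM lo hi Λ β νh Kb CK cK) (hlo : 0 < lo) (hhi : 0 ≤ hi) (hΛ : 1 ≤ Λ) (hCK : 0 ≤ CK)
    {ν : ℝ} (hν : ν ∈ Set.Ioo 0 νh) {n : ℕ} (hn : 1 ≤ n) {𝔸 : Visc4 (Fin 3)} (hodd : OddSmall 𝔸 (ν * β))
    (hwin : ∃ lam ∈ Set.Icc (1:ℝ) Λ, NearIso 𝔸 (ν * (lo / lam)) (ν * (hi * lam)))
    {Tw : ℝ} {U : ℝ → ℝ → (V2 →L[ℝ] V2)} (hU : IsPropagator Tw (cellField W M hM ν hν.1 n) ((1 / (n:ℝ) ^ 2) • 𝔸) U)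
    {s t : ℝ} (hs : 0 ≤ s) (hst : s ≤ t) (htT : t ≤ Tw) (hsT : s < Tw)
    (hphase : ∀ τ, cellField W M hM ν hν.1 n (s + τ) = cellField W M hM ν hν.1 n τ)
    {L : ℝ} (hL : 0 < L) (hKL : (n : ℝ) * ν ≤ Kb * L)
    {ℓ : Fin 3 → ℤ} (hℓ0 : ℓ ≠ 0) (hℓL : L ≤ ‖Torus.latticeVec ℓ‖) (hℓn : 2 * ‖Torus.latticeVec ℓ‖ ≤ n)
    (v : V2) (hv : v ∈ divFreeL2 (Fin 3))
    (hvs : ∀ k', fc v k' ≠ 0 → (∀ i, (n:ℤ) ∣ k' i - ℓ i) ∨ (∀ i, (n:ℤ) ∣ k' i + ℓ i)) :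
    ‖U s t v‖ ≤ Real.sqrt CK * Real.exp (-(cK * ν * (t - s))) * ‖v‖ := by
  classical
  set Pσ := (divFreeL2 (Fin 3)).starProjection with hPσ
  -- the solenoidal projections of the truncations
  set TN : ℕ → V2 := fun N => ((FunctionSpaces.Torus.isSmooth_fourierTruncate N (v : VF)).memLp 2).toLp
    (FunctionSpaces.Torus.fourierTruncate N (v : VF)) with hTN
  set vN : ℕ → V2 := fun N => Pσ (TN N) with hvN
  have hTNc : ∀ N k', fc (TN N) k' = if k' ∈ Torus.freqBall (d := Fin 3) N then fc v k' else 0 := fun N k' => fc_toLp_fourierTruncate N v k'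
  have hvNdom : ∀ N k', ‖fc (vN N) k'‖ ≤ ‖fc (TN N) k'‖ := fun N k' => norm_mFourierCoeff_starProjection_le (TN N) k'
  have hvNmem : ∀ N, vN N ∈ divFreeL2 (Fin 3) := fun N => (divFreeL2 (Fin 3)).starProjection_apply_mem (TN N)
  have hvNsupp : ∀ N k', k' ∉ Torus.freqBall (d := Fin 3) N → fc (vN N) k' = 0 := by
    intro N k' hk'
    have h := hvNdom N k'; rw [hTNc, if_neg hk', norm_zero] at h
    exact norm_le_zero_iff.1 h
  have hvNcp : ∀ N k', fc (vN N) k' ≠ 0 → (∀ i, (n:ℤ) ∣ k' i - ℓ i) ∨ (∀ i, (n:ℤ) ∣ k' i + ℓ i) := by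
    intro N k' hk'
    refine hvs k' fun h0 => hk' ?_
    have h := hvNdom N k'; rw [hTNc] at h
    split_ifs at h with hmem
    · rw [h0, norm_zero] at h; exact norm_le_zero_iff.1 h
    · rw [norm_zero] at h; exact norm_le_zero_iff.1 h
  -- the bound on each `vN N`
  have hbN : ∀ N, ‖U s t (vN N)‖ ≤ Real.sqrt CK * Real.exp (-(cK * ν * (t - s))) * ‖vN N‖ := fun N =>
    norm_apply_le_of_highLabelDecay_supp W M hM hH hlo hhi hΛ hCK hν hn hodd hwin hU hs hst htT hsT hphase hL hKL hℓ0 hℓL hℓn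
      (vN N) (hvNmem N) (hvNcp N) (hvNsupp N)
  -- `TN N → v`, hence `vN N → Pσ v = v`
  have hTNt : Tendsto TN atTop (𝓝 v) := tendsto_toLp_fourierTruncate_V2 v
  have hvself : Pσ v = v := Submodule.starProjection_eq_self_iff.2 hv
  have hvNt : Tendsto vN atTop (𝓝 v) := by
    have h := (Pσ.continuous.tendsto v).comp hTNt
    rwa [hvself] at h
  have hl : Tendsto (fun N => ‖U s t (vN N)‖) atTop (𝓝 ‖U s t v‖) :=
    (continuous_norm.tendsto _).comp (((U s t).continuous.tendsto v).comp hvNt)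
  have hr : Tendsto (fun N => Real.sqrt CK * Real.exp (-(cK * ν * (t - s))) * ‖vN N‖) atTop
      (𝓝 (Real.sqrt CK * Real.exp (-(cK * ν * (t - s))) * ‖v‖)) :=
    ((continuous_norm.tendsto _).comp hvNt).const_mul _
  exact le_of_tendsto_of_tendsto' hl hr hbN

/-! ## §4 General carrier phase: move to the next grid point -/

set_option maxHeartbeats 1600000 in
/-- **W7 AT THE PROPAGATOR LEVEL, GENERAL PHASE.**  For a window `0 ≤ s ≤ t ≤ Tw` of length `t − s ≥ P := M·W.period/ν`, `ν < νh`,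
`n·ν ≤ Kb·L`, `cK ≥ 0`, and ANY `v ∈ V2` carried by the class pair of a label `ℓ` with `L ≤ ‖ℓ‖`, `2‖ℓ‖ ≤ n` (the cell member sees only `P_σ v`):
`‖U s t v‖ ≤ √CK·exp(cK·M·W.period)·exp(−cK·ν·(t−s))·‖v‖` (the state at the next grid point `⌈s/P⌉·P` is again a class-pair datum; restart there).
[cite: BedrossianCotiZelati2017, Thm 1.1] [cite: Pazy1983, Ch. 5 §5.1 Thm. 5.3] -/
theorem norm_apply_le_of_highLabelDecay_anyPhase (W : LatticeWord k) (M : ℝ) (hM : 0 < M) {lo hi Λ β νh Kb CK cK : ℝ}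
    (hH : HighLabelDecayW W M hM lo hi Λ β νh Kb CK cK) (hlo : 0 < lo) (hhi : 0 ≤ hi) (hΛ : 1 ≤ Λ) (hCK : 0 ≤ CK) (hcK : 0 ≤ cK)
    {ν : ℝ} (hν : ν ∈ Set.Ioo 0 νh) {n : ℕ} (hn : 1 ≤ n) {𝔸 : Visc4 (Fin 3)} (hodd : OddSmall 𝔸 (ν * β))
    (hwin : ∃ lam ∈ Set.Icc (1:ℝ) Λ, NearIso 𝔸 (ν * (lo / lam)) (ν * (hi * lam)))
    {Tw : ℝ} {U : ℝ → ℝ → (V2 →L[ℝ] V2)} (hU : IsPropagator Tw (cellField W M hM ν hν.1 n) ((1 / (n:ℝ) ^ 2) • 𝔸) U)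
    {s t : ℝ} (hs : 0 ≤ s) (hPst : M * W.period / ν ≤ t - s) (htT : t ≤ Tw)
    {L : ℝ} (hL : 0 < L) (hKL : (n : ℝ) * ν ≤ Kb * L)
    {ℓ : Fin 3 → ℤ} (hℓ0 : ℓ ≠ 0) (hℓL : L ≤ ‖Torus.latticeVec ℓ‖) (hℓn : 2 * ‖Torus.latticeVec ℓ‖ ≤ n)
    (v : V2) (hvs : ∀ k', fc v k' ≠ 0 → (∀ i, (n:ℤ) ∣ k' i - ℓ i) ∨ (∀ i, (n:ℤ) ∣ k' i + ℓ i)) :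
    ‖U s t v‖ ≤ Real.sqrt CK * Real.exp (cK * (M * W.period)) * Real.exp (-(cK * ν * (t - s))) * ‖v‖ := by
  classical
  have hnpos : 0 < n := hn
  have hn0 : (0:ℝ) < n := by exact_mod_cast hnpos
  have hn2 : (0:ℝ) < 1 / (n:ℝ) ^ 2 := by positivity
  have hWp : 0 < W.period :=
    Summit.AnomalousDissipation.AnomalousDissipation.Theorems.SolenoidalFractalHomogenisation.PermissibleCarrier.period_pos W
  set P : ℝ := M * W.period / ν with hP
  have hP0 : 0 < P := by rw [hP]; exact div_pos (mul_pos hM hWp) hν.1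
  -- the next grid point
  set j : ℕ := ⌈s / P⌉₊ with hj
  set s₁ : ℝ := j * P with hs₁
  have hss₁ : s ≤ s₁ := by
    have h := Nat.le_ceil (s / P)
    rw [hs₁]; rwa [div_le_iff₀ hP0] at h
  have hs₁s : s₁ < s + P := by
    have h := Nat.ceil_lt_add_one (div_nonneg hs hP0.le)
    have : (j:ℝ) * P < (s / P + 1) * P := mul_lt_mul_of_pos_right h hP0
    rw [hs₁]; calc (j:ℝ) * P < (s / P + 1) * P := this
      _ = s + P := by field_simp
  have hs₁t : s₁ ≤ t := by linarith
  have hs₁T : s₁ < Tw := by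
    -- `s₁ < s + P ≤ t ≤ Tw`
    linarith
  have hs₁0 : 0 ≤ s₁ := hs.trans hss₁
  -- member facts for class preservation
  obtain ⟨lam, hlam, hA𝔸⟩ := hwin
  have hlam0 : 0 < lam := by linarith [hlam.1]
  have hcell : NearIso ((1 / (n:ℝ) ^ 2) • 𝔸) ((1 / (n:ℝ) ^ 2) * (ν * (lo / lam))) ((1 / (n:ℝ) ^ 2) * (ν * (hi * lam))) :=
    hA𝔸.smul hn2.le
  have hcell_lo : 0 < (1 / (n:ℝ) ^ 2) * (ν * (lo / lam)) := mul_pos hn2 (mul_pos hν.1 (div_pos hlo hlam0))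
  have hbU : MemLp (FunctionSpaces.Torus.stLift (cellField W M hM ν hν.1 n)) ∞
      (volume.restrict (Ioo 0 Tw ×ˢ (univ : Set (EuclideanSpace ℝ (Fin 3))))) := memLp_top_stLift_cell _ n Tw
  have hbUdiv : ∀ᵐ τ ∂(volume.restrict (Ioo (0:ℝ) Tw)), FunctionSpaces.Torus.IsWeaklyDivFree (cellField W M hM ν hν.1 n τ) :=
    ae_of_all _ fun τ => (isDivFree_cell _ n τ).isWeaklyDivFree_holds (isSmooth_cell _ n τ)
  have hgrid : ∀ (j' : Fin 3 → Fin n) (τ : ℝ) (y : UnitAddTorus (Fin 3)),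
      cellField W M hM ν hν.1 n τ (y + (fun i => ((((j' i : ℕ) : ℝ) / n : ℝ) : UnitAddCircle))) = cellField W M hM ν hν.1 n τ y :=
    fun j' τ y => by unfold cellField; exact cell_add_grid _ hnpos j' τ y
  -- the state at the grid point
  set y : V2 := U s s₁ v with hy
  have hydf : y ∈ divFreeL2 (Fin 3) := (mem_divFreeL2_iff _).2 (hU.divFree s s₁ v)
  have hycp : ∀ k', fc y k' ≠ 0 → (∀ i, (n:ℤ) ∣ k' i - ℓ i) ∨ (∀ i, (n:ℤ) ∣ k' i + ℓ i) := by
    intro k' hk'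
    by_contra hnot
    -- `v` vanishes on the class pair of `k'`, hence so does `U s s₁ v`
    have hvk : ∀ k'', ((∀ i, (n:ℤ) ∣ k'' i - k' i) ∨ (∀ i, (n:ℤ) ∣ k'' i + k' i)) →
        mFourierCoeff (FunctionSpaces.EuclideanSpace.complexify ∘ ⇑v) k'' = 0 := by
      intro k'' hk''
      by_contra hne
      exact hnot (classPair_of_classPair_of_classPair hk'' (hvs k'' hne))
    have h := PropagatorSymm.fcoeff_apply_eq_zero_of_classes hU hcell hcell_lo hbU hbUdiv hnpos hgrid k' hs hss₁ hs₁T.le v hvk k'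
      (Or.inl fun i => by simp)
    exact hk' h
  have hyn : ‖y‖ ≤ ‖v‖ := hU.norm_le s s₁ v
  -- restart at the grid point (carrier phase 0 there)
  have hphase : ∀ τ, cellField W M hM ν hν.1 n (s₁ + τ) = cellField W M hM ν hν.1 n τ := fun τ => by
    rw [hs₁, hP]; exact cellField_add_nat_mul_period W M hM ν hν.1 n j τ
  have hstep := norm_apply_le_of_highLabelDecay_classPair W M hM hH hlo hhi hΛ hCK hν hn hodd ⟨lam, hlam, hA𝔸⟩ hU hs₁0 hs₁t htT hs₁T
    hphase hL hKL hℓ0 hℓL hℓn y hydf hycp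
  have hcomp : U s t v = U s₁ t y := by rw [hy, hU.comp s s₁ t hs hss₁ hs₁t htT]
  -- `exp(−cKν(t−s₁)) ≤ exp(cK·M·Wp)·exp(−cKν(t−s))` (uses `cK ≥ 0`, `s₁ − s ≤ P`, `νP = M·Wp`)
  have hexp : Real.exp (-(cK * ν * (t - s₁))) ≤ Real.exp (cK * (M * W.period)) * Real.exp (-(cK * ν * (t - s))) := by
    rw [← Real.exp_add]
    apply Real.exp_le_exp.2
    have hν0 : ν ≠ 0 := ne_of_gt hν.1
    have hνP : ν * P = M * W.period := by rw [hP]; field_simp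
    have h1 : -(cK * ν * (t - s₁)) = cK * ν * (s₁ - s) + -(cK * ν * (t - s)) := by ring
    rw [h1]
    have h2 : cK * ν * (s₁ - s) ≤ cK * ν * P := mul_le_mul_of_nonneg_left (by linarith) (mul_nonneg hcK hν.1.le)
    have h3 : cK * ν * P = cK * (M * W.period) := by rw [← hνP]; ring
    linarith
  rw [hcomp]
  calc ‖U s₁ t y‖ ≤ Real.sqrt CK * Real.exp (-(cK * ν * (t - s₁))) * ‖y‖ := hstep
    _ ≤ Real.sqrt CK * (Real.exp (cK * (M * W.period)) * Real.exp (-(cK * ν * (t - s)))) * ‖v‖ := by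
        gcongr
    _ = _ := by ring

end Summit.AnomalousDissipation.AnomalousDissipation.Theorems.SolenoidalFractalHomogenisation.LagrangianStep.VmodGen

end
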